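import Summits.Ventures.DiscreteObjects.PP12.LiveCellsLift

/-!
# A liftable STD₂[n;n/2] lifts to a projective plane of order n with an involutory elation (kernel; the HIT direction)
Framing: lottery ticket; floor = certified bounds/negative ranges.

Cell pub-namedobj (venture DiscreteObjects), target (M), designs gen 9.  Converse of `InvolutionLift`: from an incidence array
`π : IncArray n u` with `IsSTD 2 π` and a GF(2) voltage `φ` solving the lift system `LiftableZ2 π φ` (`2 ≤ n`, `0 < u`) we BUILD
a Mathlib `Configuration.ProjectivePlane`:
* points `LPt π φ` = lifted points `aff i a s` (`s : ZMod 2`), axis points `ax j`, the centre `ctr`; lines `LLn π φ` = lifted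
  blocks `aff j b t`, class lines `cls i`, the axis `axis`; incidence: `aff i a s ∈ aff j b t ↔ π i j a = b ∧ φ i a j = s + t`,
  `aff i _ _ ∈ cls i`, `ax j ∈ aff j _ _`, `ax j ∈ axis`, `ctr ∈ cls i`, `ctr ∈ axis`;
* `liftedPlane` : `ProjectivePlane (LPt π φ) (LLn π φ)` — two points lie on a line (the point half of the lift system picks the
  right sheet), at most one (again the point half), and `|points| = |lines|` gives the intersections (Mathlib
  `HasLines.hasPoints`); `order_liftedPlane`: its order is `n` (the axis carries `n + 1` points);
* `flip` — the sheet swap `s ↦ s + 1` is a collineation with `flip² = 1`, `flip ≠ 1` (an involutory elation with axis `axis`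
  and centre `ctr`).
Consequently (`noLiftableSTD2_12_6_of_noInvolutionOrder12`, with `InvolutionLift`): **`noInvolutionOrder12_iff_noLiftable` :
`NoInvolutionOrder12 ↔ NoLiftableSTD2_12_6`** — the live cell `|G| = 2` of PP(12) IS the finite array statement, in the kernel;
and an explicit liftable STD₂[12;6] (`IsSTD`, `LiftableZ2` are decidable on explicit data) would be a projective plane of order 12
(`exists_plane_of_liftable`, the census HIT route).  Only the point halves of `IsSTD 2` / `LiftableZ2` are used for the lift.
(+) CONTROLS of the machinery in the kernel (`decide` on explicit data + the general construction): the trivial STD₂[2;1] lifts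
to a plane of order 2 (`exists_plane_order_two`) and the class-regular STD₂[4;2] over `Z₂` (from the Hadamard matrix of order 4)
with an explicit voltage lifts to a plane of order 4 (`exists_plane_order_four`).  Formalisation ours; no `sorry`.
-/

namespace Summit.Ventures.DiscreteObjects.PP12

open Configuration Finset Summit.Ventures.DiscreteObjects.STD

section Lift

variable {n u : ℕ}

/-- points of the lift: affine points `(i, a, s)`, axis points `j`, the centre -/
inductive LPt (π : IncArray n u) (φ : Fin n → Fin u → Fin n → ZMod 2) : Type
  | aff (i : Fin n) (a : Fin u) (s : ZMod 2)
  | ax (j : Fin n)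
  | ctr
  deriving DecidableEq, Fintype

/-- lines of the lift: lifted blocks `(j, b, t)`, class lines `i`, the axis -/
inductive LLn (π : IncArray n u) (φ : Fin n → Fin u → Fin n → ZMod 2) : Type
  | aff (j : Fin n) (b : Fin u) (t : ZMod 2)
  | cls (i : Fin n)
  | axis
  deriving DecidableEq, Fintype

variable {π : IncArray n u} {φ : Fin n → Fin u → Fin n → ZMod 2}

/-- incidence of the lift -/
def LPt.Inc : LPt π φ → LLn π φ → Prop
  | .aff i a s, .aff j b t => π i j a = b ∧ φ i a j = s + t
  | .aff i _ _, .cls i' => i = i'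
  | .aff _ _ _, .axis => False
  | .ax j, .aff j' _ _ => j = j'
  | .ax _, .cls _ => False
  | .ax _, .axis => True
  | .ctr, .aff _ _ _ => False
  | .ctr, .cls _ => True
  | .ctr, .axis => True

/-- incidence as membership -/
instance : Membership (LPt π φ) (LLn π φ) := ⟨fun m p => LPt.Inc p m⟩

/-- affine point on lifted block -/
@[simp] theorem aff_mem_aff {i : Fin n} {a : Fin u} {s : ZMod 2} {j : Fin n} {b : Fin u} {t : ZMod 2} :
    (LPt.aff i a s : LPt π φ) ∈ (LLn.aff j b t : LLn π φ) ↔ π i j a = b ∧ φ i a j = s + t := Iff.rfl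
/-- affine point on class line -/
@[simp] theorem aff_mem_cls {i : Fin n} {a : Fin u} {s : ZMod 2} {i' : Fin n} :
    (LPt.aff i a s : LPt π φ) ∈ (LLn.cls i' : LLn π φ) ↔ i = i' := Iff.rfl
/-- affine points are off the axis -/
@[simp] theorem aff_mem_axis {i : Fin n} {a : Fin u} {s : ZMod 2} :
    (LPt.aff i a s : LPt π φ) ∈ (LLn.axis : LLn π φ) ↔ False := Iff.rfl
/-- axis point on lifted block -/
@[simp] theorem ax_mem_aff {j j' : Fin n} {b : Fin u} {t : ZMod 2} :
    (LPt.ax j : LPt π φ) ∈ (LLn.aff j' b t : LLn π φ) ↔ j = j' := Iff.rfl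
/-- axis points are off the class lines -/
@[simp] theorem ax_mem_cls {j i : Fin n} : (LPt.ax j : LPt π φ) ∈ (LLn.cls i : LLn π φ) ↔ False := Iff.rfl
/-- axis points are on the axis -/
@[simp] theorem ax_mem_axis {j : Fin n} : (LPt.ax j : LPt π φ) ∈ (LLn.axis : LLn π φ) ↔ True := Iff.rfl
/-- the centre is off the lifted blocks -/
@[simp] theorem ctr_mem_aff {j : Fin n} {b : Fin u} {t : ZMod 2} :
    (LPt.ctr : LPt π φ) ∈ (LLn.aff j b t : LLn π φ) ↔ False := Iff.rfl
/-- the centre is on every class line -/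
@[simp] theorem ctr_mem_cls {i : Fin n} : (LPt.ctr : LPt π φ) ∈ (LLn.cls i : LLn π φ) ↔ True := Iff.rfl
/-- the centre is on the axis -/
@[simp] theorem ctr_mem_axis : (LPt.ctr : LPt π φ) ∈ (LLn.axis : LLn π φ) ↔ True := Iff.rfl

/-- `ZMod 2` bookkeeping for sheets -/
theorem zmod2_sheet :
    (∀ x s : ZMod 2, x = s + (x + s)) ∧ (∀ x y s s' : ZMod 2, x + y = s + s' → y = s' + (x + s)) ∧
    (∀ d₁ d₂ c : ZMod 2, d₁ + d₂ = 1 → d₁ ≠ c → d₂ = c) ∧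
    (∀ s s' t t' : ZMod 2, s + t + (s' + t) + (s + t') + (s' + t') ≠ 1) ∧
    (∀ x s s' t : ZMod 2, x = s + t → x = s' + t → s = s') ∧ (∀ x s t t' : ZMod 2, x = s + t → x = s + t' → t = t') ∧
    (∀ s t : ZMod 2, s + 1 + (t + 1) = s + t) ∧ (∀ s : ZMod 2, s + 1 + 1 = s) ∧ (∀ s : ZMod 2, s + 1 ≠ s) := by
  refine ⟨by decide, by decide, by decide, by decide, by decide, by decide, by decide, by decide, by decide⟩

/-- **Two distinct points of the lift lie on a common line.** -/
theorem exists_join (hπ : IsSTD 2 π) (hφ : LiftableZ2 π φ) (p q : LPt π φ) (hpq : p ≠ q) :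
    ∃ m : LLn π φ, p ∈ m ∧ q ∈ m := by
  obtain ⟨z1, z2, z3, -⟩ := zmod2_sheet
  rcases p with ⟨i, a, s⟩ | j | _ <;> rcases q with ⟨i', a', s'⟩ | j' | _
  · -- two affine points
    by_cases hii' : i = i'
    · exact ⟨LLn.cls i, by simp, by simp [hii']⟩
    -- different classes: two common block classes, the voltage picks the sheet
    obtain ⟨j₁, j₂, hj, hJ⟩ := card_eq_two.mp (hπ.1 i i' hii' a a')
    have hj₁ : π i j₁ a = π i' j₁ a' := by
      have h : j₁ ∈ ({j₁, j₂} : Finset (Fin n)) := by simp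
      rw [← hJ] at h; exact (mem_filter.mp h).2
    have hj₂ : π i j₂ a = π i' j₂ a' := by
      have h : j₂ ∈ ({j₁, j₂} : Finset (Fin n)) := by simp
      rw [← hJ] at h; exact (mem_filter.mp h).2
    have hsum := hφ.1 i i' hii' a a' j₁ j₂ hj hj₁ hj₂
    by_cases hk : φ i a j₁ + φ i' a' j₁ = s + s'
    · exact ⟨LLn.aff j₁ (π i j₁ a) (φ i a j₁ + s), by rw [aff_mem_aff]; exact ⟨rfl, z1 _ _⟩, by
        rw [aff_mem_aff]; exact ⟨hj₁.symm, z2 _ _ _ _ hk⟩⟩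
    · have hk' : φ i a j₂ + φ i' a' j₂ = s + s' := z3 _ _ _ (by rw [← add_assoc]; exact hsum) hk
      exact ⟨LLn.aff j₂ (π i j₂ a) (φ i a j₂ + s), by rw [aff_mem_aff]; exact ⟨rfl, z1 _ _⟩, by
        rw [aff_mem_aff]; exact ⟨hj₂.symm, z2 _ _ _ _ hk'⟩⟩
  · -- affine point and axis point `j'`: the lifted block of class `j'` through the point
    exact ⟨LLn.aff j' (π i j' a) (φ i a j' + s), by rw [aff_mem_aff]; exact ⟨rfl, z1 _ _⟩, by simp⟩
  · exact ⟨LLn.cls i, by simp, by simp⟩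
  · exact ⟨LLn.aff j (π i' j a') (φ i' a' j + s'), by simp, by rw [aff_mem_aff]; exact ⟨rfl, z1 _ _⟩⟩
  · exact ⟨LLn.axis, by simp, by simp⟩
  · exact ⟨LLn.axis, by simp, by simp⟩
  · exact ⟨LLn.cls i', by simp, by simp⟩
  · exact ⟨LLn.axis, by simp, by simp⟩
  · exact absurd rfl hpq

/-- case of `eq_or_eq_lift`: four affine objects -/
theorem eq_or_eq_aaaa (hφ : LiftableZ2 π φ) {i i' j j' : Fin n} {a a' b b' : Fin u} {s s' t t' : ZMod 2}
    (h1 : π i j a = b ∧ φ i a j = s + t) (h2 : π i' j a' = b ∧ φ i' a' j = s' + t)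
    (h3 : π i j' a = b' ∧ φ i a j' = s + t') (h4 : π i' j' a' = b' ∧ φ i' a' j' = s' + t') :
    (LPt.aff i a s : LPt π φ) = LPt.aff i' a' s' ∨ (LLn.aff j b t : LLn π φ) = LLn.aff j' b' t' := by
  obtain ⟨-, -, -, z4, z5, z6, -⟩ := zmod2_sheet
  by_cases hii' : i = i'
  · subst hii'
    left
    have haa : a = a' := (π i j).injective (h1.1.trans h2.1.symm)
    subst haa
    rw [z5 _ _ _ _ h1.2 h2.2]
  · right
    by_cases hjj : j = j'
    · subst hjj
      rw [h1.1.symm.trans h3.1, z6 _ _ _ _ h1.2 h3.2]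
    · exfalso
      have hs := hφ.1 i i' hii' a a' j j' hjj (h1.1.trans h2.1.symm) (h3.1.trans h4.1.symm)
      rw [h1.2, h2.2, h3.2, h4.2] at hs
      exact z4 _ _ _ _ hs

/-- case: two affine points on an affine line and a class line -/
theorem eq_or_eq_aaac {i i' j i₀ : Fin n} {a a' b : Fin u} {s s' t : ZMod 2}
    (h1 : π i j a = b ∧ φ i a j = s + t) (h2 : π i' j a' = b ∧ φ i' a' j = s' + t) (h3 : i = i₀) (h4 : i' = i₀) :
    (LPt.aff i a s : LPt π φ) = LPt.aff i' a' s' ∨ (LLn.aff j b t : LLn π φ) = LLn.cls i₀ := by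
  obtain ⟨-, -, -, -, z5, -⟩ := zmod2_sheet
  subst h3; subst h4
  left
  have haa : a = a' := (π _ _).injective (h1.1.trans h2.1.symm)
  subst haa
  rw [z5 _ _ _ _ h1.2 h2.2]

/-- case: two affine points on a class line and an affine line -/
theorem eq_or_eq_aaca {i i' j i₀ : Fin n} {a a' b : Fin u} {s s' t : ZMod 2}
    (h1 : i = i₀) (h2 : i' = i₀) (h3 : π i j a = b ∧ φ i a j = s + t) (h4 : π i' j a' = b ∧ φ i' a' j = s' + t) :
    (LPt.aff i a s : LPt π φ) = LPt.aff i' a' s' ∨ (LLn.cls i₀ : LLn π φ) = LLn.aff j b t := by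
  rcases eq_or_eq_aaac (π := π) (φ := φ) h3 h4 h1 h2 with h | h
  · exact Or.inl h
  · exact Or.inr h.symm

/-- case: an affine point and an axis point on two affine lines -/
theorem eq_or_eq_axaa {i j j' j₀ : Fin n} {a b b' : Fin u} {s t t' : ZMod 2}
    (h1 : π i j a = b ∧ φ i a j = s + t) (h2 : j₀ = j) (h3 : π i j' a = b' ∧ φ i a j' = s + t') (h4 : j₀ = j') :
    (LPt.aff i a s : LPt π φ) = LPt.ax j₀ ∨ (LLn.aff j b t : LLn π φ) = LLn.aff j' b' t' := by
  obtain ⟨-, -, -, -, -, z6, -⟩ := zmod2_sheet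
  subst h2; subst h4
  right
  rw [h1.1.symm.trans h3.1, z6 _ _ _ _ h1.2 h3.2]

/-- case: an axis point and an affine point on two affine lines -/
theorem eq_or_eq_xaaa {i j j' j₀ : Fin n} {a b b' : Fin u} {s t t' : ZMod 2}
    (h1 : j₀ = j) (h2 : π i j a = b ∧ φ i a j = s + t) (h3 : j₀ = j') (h4 : π i j' a = b' ∧ φ i a j' = s + t') :
    (LPt.ax j₀ : LPt π φ) = LPt.aff i a s ∨ (LLn.aff j b t : LLn π φ) = LLn.aff j' b' t' := by
  rcases eq_or_eq_axaa (π := π) (φ := φ) h2 h1 h4 h3 with h | h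
  · exact Or.inl h.symm
  · exact Or.inr h

/-- **Two points lie on at most one line** (the point half of the lift system). -/
theorem eq_or_eq_lift (hφ : LiftableZ2 π φ) {p₁ p₂ : LPt π φ} {l₁ l₂ : LLn π φ} (h1 : p₁ ∈ l₁) (h2 : p₂ ∈ l₁)
    (h3 : p₁ ∈ l₂) (h4 : p₂ ∈ l₂) : p₁ = p₂ ∨ l₁ = l₂ := by
  rcases p₁ with ⟨i, a, s⟩ | j₀ | _ <;> rcases p₂ with ⟨i', a', s'⟩ | j₀' | _ <;>
    rcases l₁ with ⟨j, b, t⟩ | i₀ | _ <;> rcases l₂ with ⟨j', b', t'⟩ | i₀' | _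
  all_goals
    simp only [aff_mem_aff, aff_mem_cls, aff_mem_axis, ax_mem_aff, ax_mem_cls, ax_mem_axis, ctr_mem_aff, ctr_mem_cls,
      ctr_mem_axis] at h1 h2 h3 h4
  all_goals first
    | exact Or.inl rfl
    | exact Or.inr rfl
    | exact eq_or_eq_aaaa hφ h1 h2 h3 h4
    | exact eq_or_eq_aaac h1 h2 h3 h4
    | exact eq_or_eq_aaca h1 h2 h3 h4
    | exact eq_or_eq_axaa h1 h2 h3 h4
    | exact eq_or_eq_xaaa h1 h2 h3 h4
    | (refine Or.inr ?_; rw [← h1, ← h3]; done)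
    | (refine Or.inr ?_; rw [← h2, ← h4]; done)
    | (refine Or.inl ?_; rw [h1, ← h2])
    | (refine Or.inl ?_; rw [h3, ← h4])

/-- the axis carries exactly the `n` axis points and the centre -/
theorem natCard_mem_axis : Nat.card {p : LPt π φ // p ∈ (LLn.axis : LLn π φ)} = n + 1 := by
  let e : {p : LPt π φ // p ∈ (LLn.axis : LLn π φ)} ≃ Option (Fin n) :=
    { toFun := fun p => match p with
        | ⟨.aff _ _ _, h⟩ => (h : False).elim
        | ⟨.ax j, _⟩ => some j
        | ⟨.ctr, _⟩ => none
      invFun := fun o => match o with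
        | some j => ⟨.ax j, trivial⟩
        | none => ⟨.ctr, trivial⟩
      left_inv := by rintro ⟨⟨i, a, s⟩ | j | _, h⟩ <;> first | exact (h : False).elim | rfl
      right_inv := by rintro (_ | j) <;> rfl }
  rw [Nat.card_congr e, Nat.card_eq_fintype_card, Fintype.card_option, Fintype.card_fin]

/-- points and lines of the lift are equinumerous -/
theorem card_LPt_eq_card_LLn : Fintype.card (LPt π φ) = Fintype.card (LLn π φ) := by
  let e : LPt π φ ≃ LLn π φ :=
    { toFun := fun p => match p with | .aff i a s => .aff i a s | .ax j => .cls j | .ctr => .axis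
      invFun := fun m => match m with | .aff j b t => .aff j b t | .cls i => .ax i | .axis => .ctr
      left_inv := by rintro (⟨i, a, s⟩ | j | _) <;> rfl
      right_inv := by rintro (⟨j, b, t⟩ | i | _) <;> rfl }
  exact Fintype.card_congr e

/-- the lift has lines through any two points (and is nondegenerate) -/
@[reducible] noncomputable def liftedHasLines (hπ : IsSTD 2 π) (hφ : LiftableZ2 π φ) (hn : 2 ≤ n) (hu : 0 < u) :
    HasLines (LPt π φ) (LLn π φ) where
  exists_point := by
    rintro (⟨j, b, t⟩ | i | _)
    · exact ⟨LPt.ctr, by simp⟩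
    · exact ⟨LPt.ax ⟨0, by omega⟩, by simp⟩
    · exact ⟨LPt.aff ⟨0, by omega⟩ ⟨0, hu⟩ 0, by simp⟩
  exists_line := by
    rintro (⟨i, a, s⟩ | j | _)
    · exact ⟨LLn.axis, by simp⟩
    · exact ⟨LLn.cls ⟨0, by omega⟩, by simp⟩
    · exact ⟨LLn.aff ⟨0, by omega⟩ ⟨0, hu⟩ 0, by simp⟩
  eq_or_eq := fun h1 h2 h3 h4 => eq_or_eq_lift hφ h1 h2 h3 h4
  mkLine := fun {p q} h => Classical.choose (exists_join hπ hφ p q h)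
  mkLine_ax := fun {p q} h => Classical.choose_spec (exists_join hπ hφ p q h)

/-- **The lift is a projective plane.** -/
@[reducible] noncomputable def liftedPlane (hπ : IsSTD 2 π) (hφ : LiftableZ2 π φ) (hn : 2 ≤ n) (hu : 0 < u) :
    ProjectivePlane (LPt π φ) (LLn π φ) :=
  let hL : HasLines (LPt π φ) (LLn π φ) := liftedHasLines hπ hφ hn hu
  let hP : HasPoints (LPt π φ) (LLn π φ) := @HasLines.hasPoints _ _ _ hL _ _ card_LPt_eq_card_LLn
  { hP, hL with
    exists_config := by
      refine ⟨LPt.aff ⟨0, by omega⟩ ⟨0, hu⟩ 0, LPt.ctr, LPt.ax ⟨0, by omega⟩,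
        LLn.aff ⟨1, by omega⟩ ⟨0, hu⟩ 0, LLn.axis, LLn.cls ⟨1, by omega⟩, ?_, ?_, ?_, ?_, ?_, ?_, ?_, ?_⟩ <;>
        simp [Fin.ext_iff] }

/-- **The lift has order `n`.** -/
theorem order_liftedPlane (hπ : IsSTD 2 π) (hφ : LiftableZ2 π φ) (hn : 2 ≤ n) (hu : 0 < u) :
    @ProjectivePlane.order (LPt π φ) (LLn π φ) _ (liftedPlane hπ hφ hn hu) = n := by
  letI := liftedPlane hπ hφ hn hu
  have h : Nat.card {p : LPt π φ // p ∈ (LLn.axis : LLn π φ)} = ProjectivePlane.order (LPt π φ) (LLn π φ) + 1 :=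
    ProjectivePlane.pointCount_eq (LPt π φ) (LLn.axis : LLn π φ)
  rw [natCard_mem_axis] at h
  omega

/-- the sheet swap on points -/
def flipPt : LPt π φ → LPt π φ
  | .aff i a s => .aff i a (s + 1)
  | .ax j => .ax j
  | .ctr => .ctr

/-- the sheet swap on lines -/
def flipLn : LLn π φ → LLn π φ
  | .aff j b t => .aff j b (t + 1)
  | .cls i => .cls i
  | .axis => .axis

/-- the sheet swap on points is an involution -/
theorem flipPt_flipPt (p : LPt π φ) : flipPt (flipPt p) = p := by
  rcases p with ⟨i, a, s⟩ | j | _ <;> simp [flipPt, zmod2_sheet.2.2.2.2.2.2.2.1]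

/-- the sheet swap on lines is an involution -/
theorem flipLn_flipLn (m : LLn π φ) : flipLn (flipLn m) = m := by
  rcases m with ⟨j, b, t⟩ | i | _ <;> simp [flipLn, zmod2_sheet.2.2.2.2.2.2.2.1]

/-- **The sheet swap is a collineation** (an involutory elation with axis `axis` and centre `ctr`). -/
def flip : Collineation (LPt π φ) (LLn π φ) where
  onPoints := ⟨flipPt, flipPt, flipPt_flipPt, flipPt_flipPt⟩
  onLines := ⟨flipLn, flipLn, flipLn_flipLn, flipLn_flipLn⟩
  mem_iff := by
    rintro (⟨i, a, s⟩ | j | _) (⟨j', b, t⟩ | i' | _) <;>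
      simp [flipPt, flipLn, zmod2_sheet.2.2.2.2.2.2.1]

/-- `flip² = 1` -/
theorem flip_sq : (flip : Collineation (LPt π φ) (LLn π φ)).onPoints ^ 2 = 1 := by
  ext p
  show flipPt (flipPt p) = p
  exact flipPt_flipPt p

/-- `flip ≠ 1` (it moves every affine point to the other sheet) -/
theorem flip_ne_one (hn' : 0 < n) (hu : 0 < u) : (flip : Collineation (LPt π φ) (LLn π φ)).onPoints ≠ 1 := by
  intro h
  have h' := congrArg (fun τ : Equiv.Perm (LPt π φ) => τ (LPt.aff ⟨0, hn'⟩ ⟨0, hu⟩ 0)) h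
  simp only [Equiv.Perm.one_apply] at h'
  have h'' : (LPt.aff ⟨0, hn'⟩ ⟨0, hu⟩ (0 + 1) : LPt π φ) = LPt.aff ⟨0, hn'⟩ ⟨0, hu⟩ 0 := h'
  simp only [LPt.aff.injEq, true_and] at h''
  exact zmod2_sheet.2.2.2.2.2.2.2.2 0 h''

end Lift

/-! ### Decidability on explicit data; controls: STD₂[2;1] and STD₂[4;2] lift to the planes of orders 2 and 4 -/

/-- `IsSTD` is decidable on explicit arrays (for kernel HIT certificates by `decide`). -/
instance decIsSTD {k u lam : ℕ} (π : IncArray k u) : Decidable (IsSTD lam π) := by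
  unfold IsSTD; infer_instance

/-- `LiftableZ2` is decidable on explicit data. -/
instance decLiftableZ2 {k u : ℕ} (π : IncArray k u) (φ : Fin k → Fin u → Fin k → ZMod 2) :
    Decidable (LiftableZ2 π φ) := by
  unfold LiftableZ2; infer_instance

/-- the trivial STD₂[2;1] (two classes of one point, every point on every block) -/
def std21 : IncArray 2 1 := fun _ _ => 1

/-- a voltage solving its lift system -/
def volt21 : Fin 2 → Fin 1 → Fin 2 → ZMod 2 := fun i _ j => if i = 0 ∧ j = 0 then 1 else 0

/-- `std21` is an STD₂[2;1] (kernel `decide`) -/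
theorem isSTD_std21 : IsSTD 2 std21 := by decide

/-- `volt21` solves the lift system of `std21` (kernel `decide`) -/
theorem liftableZ2_volt21 : LiftableZ2 std21 volt21 := by decide

/-- **(+) control of the lift machinery:** the lift of `(std21, volt21)` is a projective plane of order 2 (the Fano plane:
4 affine points, 2 axis points and the centre). -/
theorem exists_plane_order_two :
    ∃ _inst : ProjectivePlane (LPt std21 volt21) (LLn std21 volt21),
      ProjectivePlane.order (LPt std21 volt21) (LLn std21 volt21) = 2 :=
  ⟨liftedPlane isSTD_std21 liftableZ2_volt21 (le_refl 2) Nat.one_pos,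
    order_liftedPlane isSTD_std21 liftableZ2_volt21 (le_refl 2) Nat.one_pos⟩

/-- the additive Hadamard matrix of order 4 (a GH(4, Z₂)) -/
def had4 : Fin 4 → Fin 4 → ZMod 2 := ![![0, 0, 0, 0], ![0, 1, 0, 1], ![0, 0, 1, 1], ![0, 1, 1, 0]]

/-- the class-regular STD₂[4;2] over `Z₂` developed from `had4`: point `(i,a)` lies on block `(j, a + had4 i j)` -/
def std42 : IncArray 4 2 := fun i j => if had4 i j = 1 then Equiv.swap 0 1 else 1

/-- a voltage solving its lift system (found by Gaussian elimination over GF(2), 32 unknowns; checked below by `decide`) -/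
def volt42 : Fin 4 → Fin 2 → Fin 4 → ZMod 2 := fun i _ j =>
  (![![1, 0, 1, 0], ![0, 1, 1, 0], ![1, 1, 0, 0], ![0, 0, 0, 0]] : Fin 4 → Fin 4 → ZMod 2) i j

/-- `std42` is an STD₂[4;2] (kernel `decide`) -/
theorem isSTD_std42 : IsSTD 2 std42 := by decide

/-- `volt42` solves the lift system of `std42` (kernel `decide`) -/
theorem liftableZ2_volt42 : LiftableZ2 std42 volt42 := by decide

/-- **(+) control of the lift machinery, order 4:** the lift of `(std42, volt42)` is a projective plane of order 4
(21 points: 16 affine, 4 on the axis, the centre). -/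
theorem exists_plane_order_four :
    ∃ _inst : ProjectivePlane (LPt std42 volt42) (LLn std42 volt42),
      ProjectivePlane.order (LPt std42 volt42) (LLn std42 volt42) = 4 :=
  ⟨liftedPlane isSTD_std42 liftableZ2_volt42 (by norm_num) (by norm_num),
    order_liftedPlane isSTD_std42 liftableZ2_volt42 (by norm_num) (by norm_num)⟩

/-! ### PP(12): the live cell `|G| = 2` is the finite array statement -/

/-- An explicit liftable STD₂[12;6] would be (a double cover description of) a projective plane of order 12 with an
involution — the census HIT route, kernel side. -/
theorem exists_plane_of_liftable (π : IncArray 12 6) (hπ : IsSTD 2 π) (φ : Fin 12 → Fin 6 → Fin 12 → ZMod 2)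
    (hφ : LiftableZ2 π φ) :
    ∃ _inst : ProjectivePlane (LPt π φ) (LLn π φ),
      ProjectivePlane.order (LPt π φ) (LLn π φ) = 12 ∧
      ∃ σ : Collineation (LPt π φ) (LLn π φ), σ.onPoints ^ 2 = 1 ∧ σ.onPoints ≠ 1 :=
  ⟨liftedPlane hπ hφ (by norm_num) (by norm_num), order_liftedPlane hπ hφ (by norm_num) (by norm_num),
    flip, flip_sq, flip_ne_one (by norm_num) (by norm_num)⟩

/-- `NoInvolutionOrder12` implies the array statement: a liftable STD₂[12;6] would lift to a plane with an involution. -/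
theorem noLiftableSTD2_12_6_of_noInvolutionOrder12 (h : NoInvolutionOrder12) : NoLiftableSTD2_12_6 := by
  intro π hπ φ hφ
  letI := liftedPlane hπ hφ (by norm_num) (by norm_num)
  have h12 := order_liftedPlane hπ hφ (by norm_num) (by norm_num)
  exact flip_ne_one (π := π) (φ := φ) (by norm_num) (by norm_num) (h (LPt π φ) (LLn π φ) h12 flip flip_sq)

/-- **The live cell `|G| = 2` of PP(12) is exactly the finite array statement (kernel):** no projective plane of order 12
admits an involution iff no STD₂[12;6] incidence array admits a GF(2) voltage solving the lift system. -/
theorem noInvolutionOrder12_iff_noLiftable : NoInvolutionOrder12 ↔ NoLiftableSTD2_12_6 :=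
  ⟨noLiftableSTD2_12_6_of_noInvolutionOrder12, noInvolutionOrder12_of_noLiftable⟩

end Summit.Ventures.DiscreteObjects.PP12
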